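import Summits.QuantumFields.BalabanUV.InfraRed.StrongCouplingTransverseMoment

/-!
# Strong-coupling front, J-SC15 (part 3/3): `QuarterCovariance` — the covariance form of the `2/9` door, its
reduction to R21's `QuarterModulus`, and the TRANSVERSE half proved for every one-link law —
observatory of the non-perturbative crossover; no mass-gap claim

IR-3 v2 TWO-FRONT CROSSOVER LEDGER, front SC (`β₀`), SU(2), `d = 4`, Wilson normalisation `β_W = 4/g²`
(tree bare coupling `β_t = β_W/2`, 't Hooft `β_W/4`).  observatory of the non-perturbative crossover; no mass-gap claim.

ABSOLUTE RULE. No internally-minted statement may enter as a cited fact. Every hypothesis is either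
kernel-proved in this package or a verbatim quotation of a PUBLISHED theorem with page reference. The
manuscript(s) under audit are NOT citable for their own disputed steps — they are the thing under
adjudication; programme-internal (2001/route/tribunal) claims are never citable.  The ONLY hypothesis in
this file is the named open node `QuarterCovariance` (`@[conjecture] def`, stated below, NOT claimed); everything else
is kernel-proved from the tree; nothing is cited (labels [folklore]).

WHAT THIS FILE PROVES:
* `QuarterCovariance` (typed, OPEN): for every `B` in the Dobrushin ball `‖B‖_op ≤ 1/3` (`= 3β_W/2` at `β_W = 2/9`),
  every `Δ` and every bounded measurable `φ`, `L`-Lipschitz for `‖·‖_F`: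
  `|Cov_{ν_B}(φ, 2 Re tr(· Δ))| ≤ L ‖Δ‖_F` (vMF units: `|Cov_{μ_m}(φ, x·e′)| ≤ 1/4` for `|m| ≤ 4/3`, chordal-1-Lipschitz
  `φ`, unit `e′` — the Haar value).
* `quarterModulus_of_quarterCovariance : QuarterCovariance → QuarterModulus` (R21's typed end-point of the single-site
  door), by the tree's covariance interpolation `abs_integral_tilted_add_sub_le_of_cov` along `B_t = B + t(B′ − B)`,
  which stays in the ball.  Hence the doors `su2_strongCouplingFront_of_quarterCovariance` (SC-a, every tree `β₀ < 1/9`),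
  `su2_dlrMassGapAt_of_quarterCovariance` (SC-b, `DLRMassGapAt 4 2 (β_W/4)`, `β_W < 2/9`),
  `su2_latticeMassGap_of_quarterCovariance` (SC-c).
* `quarterCovariance_transverse` (HYPOTHESIS-FREE, every `B`, no smallness): the bound of `QuarterCovariance` for every
  direction `Δ` TRANSVERSE to the tilt (`Re(qp Δ · conj(qp B)) = 0`), with the floor constant exactly: reflection
  coupling (part 1) + transverse second moment `≤ 1/4` at every tilt (part 2) + `√2 |qp Δ| ≤ ‖Δ‖_F`; in particular
  `quarterCovariance_zero`: the bound at `B = 0` for EVERY `Δ` (sharp there by R21's floor `oneLinkKRModulusSU2_floor`).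
CONSEQUENCE FOR THE LEDGER.  What stands between the tree and `β_W < 2/9` (K) ON THIS DOOR is now isolated as the
OBLIQUE case of `QuarterCovariance` (directions `Δ` with `qp Δ` not orthogonal to `qp B`, `0 < ‖B‖_op ≤ 1/3`).  Evidence
that it holds (NOT load-bearing; FRONT-SC §3k–§3l, kit j080334): two LP engines give `max_{e′} K = 0.2492 ∕ 0.2480 ∕
0.2451 ∕ 0.2405 ∕ 0.2355 ∕ 0.2315` at `|m| = 0 ∕ .3 ∕ .6 ∕ .9 ∕ 1.155 ∕ 4/3`, the worst direction being the transverse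
one proved here.  Dead ends for the oblique case recorded in FRONT-SC §3l (term-wise parity split loses `√2`;
Γ₂/Cauchy–Schwarz routes stop at `8/(9π)` resp. `1/√12 > 1/4`).

NOT CLAIMED: `QuarterCovariance`, `QuarterModulus`, `β_W < 2/9`; the owned hypothesis-free number of the ledger stays
`β_W < √3/9 = 0.19245` (J-SC13).  No mass-gap claim; nothing about the continuum or `N ≥ 3`.
-/

noncomputable section

open MeasureTheory Filter Topology ProbabilityTheory Finset Real
open scoped NNReal Quaternion
open Literature.Probability.LatticeModels
open Literature.MathematicalPhysics.QuantumLattice (fundamentalRep fundamentalLatticeRep quatMatrix su2Quat quatToSU2)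
open Literature.MathematicalPhysics.QuantumFieldTheory
open Literature.MathematicalPhysics.QuantumFieldTheory.Balaban1983to89
open Literature.MathematicalPhysics.QuantumFieldTheory.Balaban1983to89.StrongCouplingDobrushinWindow
open Literature.MathematicalPhysics.QuantumFieldTheory.Balaban1983to89.StrongCouplingTorusWindow
open Literature.MathematicalPhysics.QuantumFieldTheory.Balaban1983to89.StrongCouplingKernelWindow
open Literature.MathematicalPhysics.QuantumFieldTheory.Balaban1983to89.StrongCouplingOpenWindow
open Literature.MathematicalPhysics.QuantumFieldTheory.Balaban1983to89.StrongCouplingVarianceWindow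
open Summit.QuantumFields.BalabanUV.InfraRed.StrongCouplingSixFifthsVariance
open Summit.QuantumFields.BalabanUV.InfraRed.StrongCouplingReflection
open Summit.QuantumFields.BalabanUV.InfraRed.StrongCouplingTransverseMoment

namespace Summit.QuantumFields.BalabanUV.InfraRed.StrongCouplingQuarterCovariance

local notation "SU2" => Matrix.specialUnitaryGroup (Fin 2) ℂ
local notation "M₂" => Matrix (Fin 2) (Fin 2) ℂ
local notation "σ₂" => haarProbability (Matrix.specialUnitaryGroup (Fin 2) ℂ)

/-! ## The covariance form of the `2/9` door -/

/-- **`QuarterCovariance` — the pointwise (covariance) form of `QuarterModulus`.**  For every one-link law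
`ν_B = σ.tilted (2 Re tr(· B))` of `SU(2)` in the Dobrushin ball `‖B‖_op ≤ 1/3` (`= 3β_W/2` at `β_W = 2/9`), every
direction `Δ ∈ M₂(ℂ)` and every bounded measurable `φ` that is `L`-Lipschitz for the Frobenius distance:
`|Cov_{ν_B}(φ, 2 Re tr(· Δ))| ≤ L ‖Δ‖_F`.  In vMF units (`x ∈ S³`, tilt `e^{m·x}`, `|m| ≤ 4/3`, chordal-1-Lipschitz `φ`,
unit `e′`): `|Cov_{μ_m}(φ, x·e′)| ≤ 1/4` — the Haar value, attained at `m = 0` by `φ = x·e′`.  PROVED in this file for the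
TRANSVERSE directions (`qp Δ ⊥ qp B`, every `B`, no smallness: `cov_pot_le_of_transverse`); OPEN for oblique directions
at `B ≠ 0` (numerical evidence, not load-bearing: FRONT-SC §3k, kit j080334, max over directions `0.2492 ∕ 0.2451 ∕ 0.2315`
at `|m| = 0 ∕ 0.6 ∕ 4/3`, worst direction transverse).  `quarterModulus_of_quarterCovariance` integrates it along segments
to R21's typed conjecture `QuarterModulus`, whence `β_W < 2/9` through R21's doors. [conjecture] -/
@[conjecture] def QuarterCovariance : Prop :=
  ∀ B Δ : Matrix (Fin 2) (Fin 2) ℂ, matrixOpNorm B ≤ 1 / 3 →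
    ∀ (φ : Matrix.specialUnitaryGroup (Fin 2) ℂ → ℝ) (L : ℝ), Measurable φ → (∃ C, ∀ s, |φ s| ≤ C) → 0 ≤ L →
      (∀ a b, |φ a - φ b| ≤ L * suFrobDist a b) →
        |∫ s, φ s * pot Δ s ∂((σ₂).tilted (pot B)) -
            (∫ s, φ s ∂((σ₂).tilted (pot B))) * ∫ s, pot Δ s ∂((σ₂).tilted (pot B))| ≤ L * frobNorm Δ

/-- **The transverse case of `QuarterCovariance`, for every `B`.**  If the direction `Δ` is transverse to the tilt
(`Re(qp Δ · conj(qp B)) = 0`, i.e. `qp Δ ⊥ qp B` in `ℝ⁴`), then `|Cov_{ν_B}(φ, 2 Re tr(· Δ))| ≤ L ‖Δ‖_F` — with NO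
smallness assumption on `B`.  Proof: the reflection `A_u`, `u = qp Δ̄/|qp Δ|`, fixes `ν_B` and negates `2 Re tr(· Δ)`;
symmetrise (`cov_le_of_reflect`), bound the transverse second moment by `1/4` (`integral_sq_tilted_le_quarter`), and
`√2 |qp Δ| ≤ ‖Δ‖_F`. [folklore] -/
theorem cov_pot_le_of_transverse (B Δ : M₂) (hT : (qp Δ * star (qp B)).re = 0) {φ : SU2 → ℝ} {L : ℝ}
    (hφm : Measurable φ) (hφb : ∃ C, ∀ s, |φ s| ≤ C) (hL : 0 ≤ L) (hφL : ∀ a b, |φ a - φ b| ≤ L * suFrobDist a b) :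
    |∫ s, φ s * pot Δ s ∂((σ₂).tilted (pot B)) -
        (∫ s, φ s ∂((σ₂).tilted (pot B))) * ∫ s, pot Δ s ∂((σ₂).tilted (pot B))| ≤ L * frobNorm Δ := by
  -- one-sided bound for every transverse `Δ`, then apply it to `Δ` and `−Δ`
  have key : ∀ Δ : M₂, (qp Δ * star (qp B)).re = 0 →
      ∫ s, φ s * pot Δ s ∂((σ₂).tilted (pot B)) -
        (∫ s, φ s ∂((σ₂).tilted (pot B))) * ∫ s, pot Δ s ∂((σ₂).tilted (pot B)) ≤ L * frobNorm Δ := by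
    intro Δ hT
    by_cases hd : qp Δ = 0
    · have hp : ∀ s, pot Δ s = 0 := fun s => by rw [pot_eq, hd, mul_zero, Quaternion.re_zero, mul_zero]
      simp only [hp, mul_zero, integral_zero, sub_zero]
      exact mul_nonneg hL (frobNorm_nonneg Δ)
    · have hn : ‖qp Δ‖ ≠ 0 := norm_ne_zero_iff.2 hd
      have hnpos : 0 < ‖qp Δ‖ := norm_pos_iff.2 hd
      set u : ℍ := ‖qp Δ‖⁻¹ • star (qp Δ) with hu'
      have hu : ‖u‖ = 1 := by rw [hu', norm_smul, norm_inv, norm_norm, norm_star, inv_mul_cancel₀ hn]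
      have hsu : star u = ‖qp Δ‖⁻¹ • qp Δ := by
        rw [hu']; ext <;> simp [Quaternion.re_smul, Quaternion.imI_smul, Quaternion.imJ_smul, Quaternion.imK_smul]
      -- `pot Δ = 4 |qp Δ| ⟨x, u⟩`
      have hΔ : ∀ g, pot Δ g = (4 * ‖qp Δ‖) * (su2Quat g * star u).re := fun g => by
        rw [pot_eq, hsu, mul_smul_comm, Quaternion.re_smul, smul_eq_mul]
        field_simp
      -- `u ⊥ qp B`, so `A_u` fixes `pot B`
      have hub : (u * qp B).re = 0 := by
        have e : (u * qp B).re = ‖qp Δ‖⁻¹ * (qp Δ * star (qp B)).re := by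
          rw [hu', smul_mul_assoc, Quaternion.re_smul, smul_eq_mul, re_mul_star, Quaternion.re_mul]
          simp only [Quaternion.re_star, Quaternion.imI_star, Quaternion.imJ_star, Quaternion.imK_star]
          ring
        rw [e, hT, mul_zero]
      have hB : ∀ g, pot B (reflect u hu g) = pot B g := fun g => by
        rw [pot_eq, pot_eq, su2Quat_reflect, re_reflect_mul_of_orth _ hu hub]
      have h1 := cov_le_of_reflect hu hB hΔ hφm hφb hφL
      have h2 := integral_sq_tilted_le_quarter B hu hub
      have h3 := sqrt_two_mul_norm_qp_le Δ
      have h4 : Real.sqrt 2 * L * |4 * ‖qp Δ‖| * ∫ s, (su2Quat s * star u).re ^ 2 ∂((σ₂).tilted (pot B)) ≤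
          Real.sqrt 2 * L * |4 * ‖qp Δ‖| * (1 / 4) :=
        mul_le_mul_of_nonneg_left h2 (by positivity)
      rw [abs_of_pos (by positivity)] at h4
      calc _ ≤ _ := h1
        _ ≤ Real.sqrt 2 * L * (4 * ‖qp Δ‖) * (1 / 4) := by rw [abs_of_pos (by positivity)]; exact h4
        _ = L * (Real.sqrt 2 * ‖qp Δ‖) := by ring
        _ ≤ L * frobNorm Δ := mul_le_mul_of_nonneg_left h3 hL
  have hneg : ∀ s, pot (-Δ) s = -pot Δ s := fun s => by
    rw [pot_eq, pot_eq]
    have : qp (-Δ) = -qp Δ := by ext <;> simp [qp] <;> ring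
    rw [this, mul_neg, Quaternion.re_neg, mul_neg]
  have hTn : (qp (-Δ) * star (qp B)).re = 0 := by
    have : qp (-Δ) = -qp Δ := by ext <;> simp [qp] <;> ring
    rw [this, neg_mul, Quaternion.re_neg, hT, neg_zero]
  have k1 := key Δ hT
  have k2 := key (-Δ) hTn
  simp only [hneg, mul_neg, integral_neg, sub_neg_eq_add] at k2
  rw [show frobNorm (-Δ) = frobNorm Δ by rw [← zero_sub, frobNorm_sub_comm, sub_zero]] at k2
  rw [abs_le]
  constructor <;> linarith

/-- **`QuarterCovariance → QuarterModulus`** (integration along the segment `B_t = B + t(B′ − B)`, which stays in the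
Dobrushin ball `‖B_t‖_op ≤ 3β_W/2 ≤ 1/3`; the tree's covariance interpolation `abs_integral_tilted_add_sub_le_of_cov`).
So the oblique case of `QuarterCovariance` is EXACTLY what stands between the tree and `β_W < 2/9` (K) on this door.
[folklore] -/
theorem quarterModulus_of_quarterCovariance (h : QuarterCovariance) : StrongCouplingDobrushinFloor.QuarterModulus := by
  classical
  intro βW h0 h29 B B' hB hB' φ L hφm hφb hL hφL
  have h2 : ((2 : ℕ) : ℝ) = 2 := by norm_num
  rw [h2, show (4 : ℝ) * (1 / 4) = 1 by norm_num, one_mul]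
  set f : SU2 → ℝ := fun g => (2 : ℝ) * (((g : M₂) * B).trace.re) with hf
  set w : SU2 → ℝ := fun g => (2 : ℝ) * (((g : M₂) * (B' - B)).trace.re) with hw
  have hfw : (fun g : SU2 => (2 : ℝ) * (((g : M₂) * B').trace.re)) = fun g => f g + w g := by
    funext g
    simp only [hf, hw, Matrix.mul_sub, Matrix.trace_sub, Complex.sub_re]
    ring
  rw [hfw, abs_sub_comm]
  have hfm : Measurable f := (continuous_pot B).measurable
  have hwm : Measurable w := (continuous_pot (B' - B)).measurable
  have hfb : ∃ C, ∀ s, |f s| ≤ C := ⟨_, abs_pot_le B⟩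
  have hwb : ∀ s, |w s| ≤ 2 * (Real.sqrt 2 * frobNorm (B' - B)) := abs_pot_le (B' - B)
  have key := abs_integral_tilted_add_sub_le_of_cov (μ := σ₂) (A := L * frobNorm (B' - B)) hfm hfb hwm hwb hφm hφb ?_
  · rw [frobNorm_sub_comm]; exact key
  · intro t ht
    set Bt : M₂ := B + (t : ℂ) • (B' - B) with hBt
    have hft : (fun u : SU2 => f u + t * w u) = pot Bt := by
      funext g
      simp only [hf, hw, hBt, pot, Matrix.mul_add, Matrix.mul_smul, Matrix.trace_add, Matrix.trace_smul,
        Complex.add_re, smul_eq_mul, Complex.re_ofReal_mul]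
      ring
    have hBt_le : matrixOpNorm Bt ≤ 1 / 3 := by
      have h1 : Bt = ((1 - t : ℝ) : ℂ) • B + ((t : ℝ) : ℂ) • B' := by
        rw [hBt]
        push_cast
        simp only [smul_sub, sub_smul, one_smul]
        abel
      rw [h1]
      calc matrixOpNorm (((1 - t : ℝ) : ℂ) • B + ((t : ℝ) : ℂ) • B')
          ≤ matrixOpNorm (((1 - t : ℝ) : ℂ) • B) + matrixOpNorm (((t : ℝ) : ℂ) • B') := matrixOpNorm_add_le _ _
        _ = (1 - t) * matrixOpNorm B + t * matrixOpNorm B' := by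
            rw [matrixOpNorm_smul, matrixOpNorm_smul, Complex.norm_real, Complex.norm_real, Real.norm_eq_abs,
              Real.norm_eq_abs, abs_of_nonneg (by linarith [ht.2]), abs_of_nonneg ht.1]
        _ ≤ (1 - t) * (3 * βW / 2) + t * (3 * βW / 2) :=
            add_le_add (mul_le_mul_of_nonneg_left hB (by linarith [ht.2])) (mul_le_mul_of_nonneg_left hB' ht.1)
        _ ≤ 1 / 3 := by linarith
    rw [hft]
    exact h Bt (B' - B) hBt_le φ L hφm hφb hL hφL

/-- **The transverse half of the `2/9` door, hypothesis-free**: for EVERY `B` and every direction `Δ` transverse to it,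
the one-link covariance bound of `QuarterCovariance` holds. [folklore] -/
theorem quarterCovariance_transverse (B Δ : M₂) (hT : (qp Δ * star (qp B)).re = 0) (φ : SU2 → ℝ) (L : ℝ)
    (hφm : Measurable φ) (hφb : ∃ C, ∀ s, |φ s| ≤ C) (hL : 0 ≤ L) (hφL : ∀ a b, |φ a - φ b| ≤ L * suFrobDist a b) :
    |∫ s, φ s * pot Δ s ∂((σ₂).tilted (pot B)) -
        (∫ s, φ s ∂((σ₂).tilted (pot B))) * ∫ s, pot Δ s ∂((σ₂).tilted (pot B))| ≤ L * frobNorm Δ :=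
  cov_pot_le_of_transverse B Δ hT hφm hφb hL hφL

/-- **`QuarterCovariance` holds at `B = 0` (Haar), for EVERY direction** — every `Δ` is transverse to the zero
tilt.  This is the chordal truth `K(0, e′) = 1/4` of FRONT-SC §3k (LEMMA 1) in tree currency; by R21's floor
(`oneLinkKRModulusSU2_floor`) the constant cannot be lowered, so the bound is SHARP here (equality for `φ = 2 Re tr(· Δ)`
up to normalisation). [folklore] -/
theorem quarterCovariance_zero (Δ : M₂) (φ : SU2 → ℝ) (L : ℝ) (hφm : Measurable φ) (hφb : ∃ C, ∀ s, |φ s| ≤ C)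
    (hL : 0 ≤ L) (hφL : ∀ a b, |φ a - φ b| ≤ L * suFrobDist a b) :
    |∫ s, φ s * pot Δ s ∂((σ₂).tilted (pot 0)) -
        (∫ s, φ s ∂((σ₂).tilted (pot 0))) * ∫ s, pot Δ s ∂((σ₂).tilted (pot 0))| ≤ L * frobNorm Δ := by
  refine cov_pot_le_of_transverse 0 Δ ?_ hφm hφb hL hφL
  have h0 : qp (0 : M₂) = 0 := by ext <;> simp [qp]
  rw [h0, star_zero, mul_zero, Quaternion.re_zero]

/-- **Door (SC-a).**  `QuarterCovariance` ⟹ the single-site Dobrushin front at every tree coupling `β₀ < 1/9`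
(Wilson `β_W < 2/9 = 0.2222`), through R21's `su2_strongCouplingFront_of_quarterModulus`. [folklore] -/
theorem su2_strongCouplingFront_of_quarterCovariance (h : QuarterCovariance) {β₀W : ℝ} (h0 : 0 ≤ β₀W)
    (hlt : β₀W < 2 / 9) : CrossoverLedger.StrongCouplingFront (fundamentalLatticeRep 2) (β₀W / 2) :=
  StrongCouplingDobrushinFloor.su2_strongCouplingFront_of_quarterModulus (quarterModulus_of_quarterCovariance h) h0 hlt

/-- **Door (SC-b).**  `QuarterCovariance` ⟹ the DLR mass gap of `SU(2)`, `d = 4` at every Wilson `0 ≤ β_W < 2/9`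
('t Hooft `β_W/4`). [folklore] -/
theorem su2_dlrMassGapAt_of_quarterCovariance (h : QuarterCovariance) {βW : ℝ} (h0 : 0 ≤ βW) (hlt : βW < 2 / 9) :
    DLRMassGapAt 4 2 (βW / 4) :=
  StrongCouplingDobrushinFloor.su2_dlrMassGapAt_of_quarterModulus (quarterModulus_of_quarterCovariance h) h0 hlt

/-- **Door (SC-c).**  `QuarterCovariance` ⟹ the ledger's `LatticeMassGap` currency at every Wilson `0 ≤ β_W < 2/9`.
[folklore] -/
theorem su2_latticeMassGap_of_quarterCovariance (h : QuarterCovariance) {βW : ℝ} (h0 : 0 ≤ βW) (hlt : βW < 2 / 9) :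
    CrossoverLedger.LatticeMassGap (fundamentalRep (Fin 2)) (βW / 2) (krRate (18 * βW * (1 / 4))) :=
  StrongCouplingDobrushinFloor.su2_latticeMassGap_of_quarterModulus (quarterModulus_of_quarterCovariance h) h0 hlt

end Summit.QuantumFields.BalabanUV.InfraRed.StrongCouplingQuarterCovariance
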